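import Summits.BirchSwinnertonDyer.BirchSwinnertonDyer.Theorems.CMKolyvaginAtInertTwoPairAssemblyCanonicalAtTwo
import Summits.BirchSwinnertonDyer.BirchSwinnertonDyer.Theorems.CMKolyvaginAtInertTwoPairAssemblyCTNondegAtTwo
import Summits.BirchSwinnertonDyer.BirchSwinnertonDyer.Theorems.CMKolyvaginAtInertTwoPairMemberCanonicalAtTwo
import Literature.NumberTheory.EllipticCurves.WeilPairingProofs
import HarnessLib

/-!
# Route `CMKolyvaginAtInertTwo`, crux `CMKolyvaginExactAtInertTwo` (stmt-BirchSwinnertonDyer-24277):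
# THE PATH-(β) T2 ASSEMBLY ON H₂ WITH THE CASSELS–TATE NONDEGENERACY DISCHARGED — the final displayed list is
# the two-member data, a Heegner point, the Cassels–Tate package and the Mordell–Weil / finiteness facts

Seat `bsd-line-cmk2-p1` g17 (cell `bsd-print-cf2`); helper (`--supports stmt-BirchSwinnertonDyer-24277`).
THEOREMS ONLY: no definition, no named fact, no `sorry`; no item is closed; BSD is not proved by this.

`card_mul_card_le_two_pow_two_mul_of_pairData_cmInert` (p720283) displays the nondegeneracy of the two canonical
Cassels–Tate pairings on `Ш[2^L]` (`hB₁nd`, `hCT₂nd`); `ctLevelPairing_canonical_nondegenerate_of_kill` (p719695: gk2-p2's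
level-pairing theorem over every number field + Cassels' alternation) derives both from the already displayed `hkill₁`,
`hkill₂` (`Ш[2^{2L}] ⊆ Ш[2^L]`, i.e. finiteness of `Ш[2^∞]` with `L ≥ v₂ #Ш[2^∞]`). This file records the composition:

* `card_mul_card_le_two_pow_two_mul_of_pairData_cmInert_of_kill` — **`#Ш(E/ℚ)[2^L] · #Sel_{2^{2L}}(E^{(d_K)}/ℚ) ≤ 2^{2·M₀}` on H₂**
  from: the habitat (`W` CM, globally minimal, `CMInert W 2`, `ρ̄_{E,2}` onto; `K` imaginary quadratic, odd `d_K`, Heegner for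
  `N_E`), a Heegner point, the two-member descent data `D` (Kolyvagin's classes over `ℚ` with Lemma 4.3 / Prop. 4.4; `D.Kol` =
  Gross-form depth-`(2L+1)` primes that are `kolPrime` of depth `2L`), the Cassels–Tate data at level `2^L` for `E` and `E^{(d_K)}`
  (Weil pairings `e₁/e₂` with their axioms, the maps `ι₁/ι₂ : Sel_{2^{2L}} → Ш[2^L]`, `hkill₁/hkill₂`), the rank-one kernel
  `ker ι₁ = ℤ·D.x` (Mordell–Weil; tool p718128) and the rank-zero injectivity of `ι₂`.

* `card_mul_card_le_two_pow_two_mul_of_pairData_cmInert_of_finite` — the same with the Cassels–Tate PACKAGE INTERNALISED: given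
  `[Finite Ш(E)]`, `[Finite Ш(E^{(d_K)})]` with `v₂ #Ш ≤ L`, the Weil pairings (`exists_weilPairing_holds`), the maps `ι`
  (`exists_selmerToSha_of_finite`) and `hkill` (`zsmul_pow_eq_zero_of_finite_of_padicValNat_le`) are obtained inside; the rank
  inputs become point-free: `hkerT : torsionH1ToH1 z = 0 ↔ ↑z ∈ ℤ·D.x` on `Sel(E)`, `hinjT : torsionH1ToH1 z = 0 → z = 0` on `Sel(E^{(d_K)})`.

With `L ≥ v₂ #Ш` on both members this is `#Ш(E)[2^∞] · #Ш(E^{(d_K)})[2^∞] ≤ 2^{2M₀}` (`…CardBridge`, p715866), the pair form of the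
crux's `stub_upper` (`ShaCountHalves`, p705380). References: [McCallumLMS1991] §1, §5 Thm. 5.4, Cor. 5.6; [Kolyvagin1989Izv] §3;
[MilneADT2006] I §6 Thm. 6.13 (a); [Cassels1962ArithmeticIV] §1.
-/

-- single-conjunct summit: `Summit.BirchSwinnertonDyer.BirchSwinnertonDyer.…` repeats the name by design
set_option linter.dupNamespace false
set_option autoImplicit false

noncomputable section

open scoped Classical
open scoped AddSubgroup
open WeierstrassCurve NumberField IsDedekindDomain Field Function Rat.HeightOneSpectrum
open Literature.NumberTheory.GaloisRepresentations
open Literature.NumberTheory.GaloisCohomology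
open Literature.NumberTheory.EllipticCurves Literature.NumberTheory.EllipticCurves.KolyvaginDescent
open Summit.BirchSwinnertonDyer.BirchSwinnertonDyer.Theorems.GenusExact.EigenClassesFinite
open Summit.BirchSwinnertonDyer.BirchSwinnertonDyer.Theorems.GenusExact.VisiblePairAtTwo

namespace Summit.BirchSwinnertonDyer.BirchSwinnertonDyer.Theorems.KolyvaginPairDataTwo

variable (W : WeierstrassCurve ℚ) {K : Type} [Field K] [NumberField K]

set_option maxHeartbeats 1600000 in
/-- **McCallum's inequality `#Ш(E/ℚ)[2^L] · #Sel_{2^{2L}}(E^{(d_K)}/ℚ) ≤ 2^{2M₀}` on H₂, Cassels–Tate nondegeneracy discharged**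
(see the module docstring for the displayed inputs). [cite: McCallumLMS1991, §5 Thm. 5.4 (proof, p. 307), Cor. 5.6]
[cite: Kolyvagin1989Izv, §3] [cite: MilneADT2006, Ch. I §6 Thm. 6.13 (a)] -/
theorem card_mul_card_le_two_pow_two_mul_of_pairData_cmInert_of_kill
    [W.IsElliptic] [W.IsGloballyMinimal] [NeZero (W.conductorNorm ℤ)] [(twin W K).IsElliptic]
    (hCM : W.HasCM) (hin : Literature.NumberTheory.EllipticCurves.Rank1Residual.CMInert W 2)
    (hρ : W.HasSurjectiveModNGaloisRep 2) (hK : IsImaginaryQuadratic K) (hoddK : Odd (NumberField.discr K))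
    (hH : SatisfiesHeegnerHypothesis (W.conductorNorm ℤ) K)
    {P₀ : (W.baseChange K).toAffine.Point} (hP₀ : IsHeegnerPoint (W.conductorNorm ℤ) W K P₀)
    {L : ℕ} (hL1 : 1 ≤ L)
    -- the two-member descent data on the `ℚ`-pair carrier
    (D : PairDataM (galH1Torsion W (lvl (L + L))) (galH1Torsion (twin W K) (lvl (L + L)))
      (HeightOneSpectrum (𝓞 ℚ) ⊕ InfinitePlace ℚ))
    (hDp : D.p = 2) (hDM : D.M = L + L)
    (hDSel₁ : D.Sel₁ = selmerGroup W (lvl (L + L)))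
    (hDSel₂ : D.Sel₂ = selmerGroup (twin W K) (lvl (L + L)))
    (hDLoc₁ : D.Loc₁ = loc₁ W (L + L)) (hDLoc₂ : D.Loc₂ = loc₂ W K (L + L))
    (hDA₁ : D.A₁ = a₁ W (L + L)) (hDA₂ : D.A₂ = a₂ W K (L + L))
    (hDpl : D.pl = pl) (hDDv : D.Dv = Dv)
    (hDKol : ∀ ℓ, D.Kol ℓ ↔ IsKolyvaginPrime (W.conductorNorm ℤ) W K 2 ℓ ∧
      FrobEqFrobInfty W K (2 ^ (L + L + 1)) ℓ ∧ kolPrime W K (L + L) ℓ)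
    (hM₀L : D.M₀ ≤ L)
    -- the Cassels–Tate data of `E` at level `2^L`
    (hkill₁ : ∀ a ∈ W.sha, ((2 : ℤ) ^ (2 * L)) • a = 0 → ((2 : ℤ) ^ L) • a = 0)
    (e₁ : geomTorsion W ((2 ^ L * 2 ^ L : ℕ) : ℤ) → geomTorsion W ((2 ^ L * 2 ^ L : ℕ) : ℤ) → AlgebraicClosure ℚ)
    (hμ₁ : ∀ S T, e₁ S T ^ (2 ^ L * 2 ^ L) = 1)
    (hadd₁₁ : ∀ S₁ S₂ T, e₁ (S₁ + S₂) T = e₁ S₁ T * e₁ S₂ T)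
    (hadd₂₁ : ∀ S T₁ T₂, e₁ S (T₁ + T₂) = e₁ S T₁ * e₁ S T₂)
    (hgal₁ : ∀ (σ : absoluteGaloisGroup ℚ) (S T : geomTorsion W ((2 ^ L * 2 ^ L : ℕ) : ℤ)),
      σ • e₁ S T = e₁ (σ • S) (σ • T))
    (halt₁ : ∀ T, e₁ T T = 1) (hnondeg₁ : ∀ T, (∀ S, e₁ S T = 1) → T = 0)
    (ι₁ : selmerGroup W (lvl (L + L)) →+ (W.sha)[(2 ^ L : ℕ)])
    (hι₁ : ∀ z, shaTorsionVal W (2 ^ L) (ι₁ z) = torsionH1ToH1 W (lvl (L + L)) z)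
    -- the Cassels–Tate data of `E^{(d_K)}` at level `2^L`
    (hkill₂ : ∀ a ∈ (twin W K).sha, ((2 : ℤ) ^ (2 * L)) • a = 0 → ((2 : ℤ) ^ L) • a = 0)
    (e₂ : geomTorsion (twin W K) ((2 ^ L * 2 ^ L : ℕ) : ℤ) → geomTorsion (twin W K) ((2 ^ L * 2 ^ L : ℕ) : ℤ) →
      AlgebraicClosure ℚ)
    (hμ₂ : ∀ S T, e₂ S T ^ (2 ^ L * 2 ^ L) = 1)
    (hadd₁₂ : ∀ S₁ S₂ T, e₂ (S₁ + S₂) T = e₂ S₁ T * e₂ S₂ T)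
    (hadd₂₂ : ∀ S T₁ T₂, e₂ S (T₁ + T₂) = e₂ S T₁ * e₂ S T₂)
    (hgal₂ : ∀ (σ : absoluteGaloisGroup ℚ) (S T : geomTorsion (twin W K) ((2 ^ L * 2 ^ L : ℕ) : ℤ)),
      σ • e₂ S T = e₂ (σ • S) (σ • T))
    (halt₂ : ∀ T, e₂ T T = 1) (hnondeg₂ : ∀ T, (∀ S, e₂ S T = 1) → T = 0)
    (ι₂ : selmerGroup (twin W K) (lvl (L + L)) →+ ((twin W K).sha)[(2 ^ L : ℕ)])
    (hι₂ : ∀ z, shaTorsionVal (twin W K) (2 ^ L) (ι₂ z) = torsionH1ToH1 (twin W K) (lvl (L + L)) z)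
    -- the abstract `ℚ`-side (the two Selmer groups are finite: `finite_selmerGroup_holds`)
    -- the rank-one member: the kernel of `ι₁` is `ℤ · D.x` (Mordell–Weil rank one, `E(ℚ)[2] = 0`, `D.x = δ(x₀)` with
    -- `x₀` an odd multiple of the generator modulo torsion: `…PairAssemblyRankOneSideAtTwo`)
    (hker : ∀ z : selmerGroup W (lvl (L + L)),
      ι₁ z = 0 ↔ (z : galH1Torsion W (lvl (L + L))) ∈ AddSubgroup.zmultiples D.x)
    -- the rank-zero member: `ι₂` injective (`E^{(d_K)}(ℚ)` finite without `2`-torsion, `Ш(E^{(d_K)})[2^{2L}] = Ш[2^L]`)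
    (hι₂inj : Function.Injective ι₂) :
    Nat.card ((W.sha)[(2 ^ L : ℕ)]) * Nat.card (selmerGroup (twin W K) (lvl (L + L))) ≤ 2 ^ (2 * D.M₀) := by
  haveI : NeZero (2 ^ L * 2 ^ L) := ⟨by positivity⟩
  have hB₁nd := ctLevelPairing_canonical_nondegenerate_of_kill W e₁ hμ₁ hadd₁₁ hadd₂₁ hgal₁ halt₁ hnondeg₁ hL1 hkill₁
  have hCT₂nd := ctLevelPairing_canonical_nondegenerate_of_kill (twin W K) e₂ hμ₂ hadd₁₂ hadd₂₂ hgal₂ halt₂ hnondeg₂ hL1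
    hkill₂
  exact card_mul_card_le_two_pow_two_mul_of_pairData_cmInert W hCM hin hρ hK hoddK hH hP₀ hL1 D hDp hDM hDSel₁ hDSel₂
    hDLoc₁ hDLoc₂ hDA₁ hDA₂ hDpl hDDv hDKol hM₀L hkill₁ e₁ hμ₁ hadd₁₁ hadd₂₁ hgal₁ halt₁ hnondeg₁ ι₁ hι₁ hkill₂ e₂ hμ₂
    hadd₁₂ hadd₂₂ hgal₂ halt₂ hnondeg₂ ι₂ hι₂ hker hι₂inj hB₁nd hCT₂nd

set_option maxHeartbeats 1600000 in
/-- **McCallum's inequality on H₂ with the Cassels–Tate package internalised** (Weil pairings, `ι`, `hkill` from the finiteness of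
the two `Ш` with `v₂ #Ш ≤ L`); the rank inputs are point-free statements on the Selmer groups. [cite: McCallumLMS1991, §5 Thm. 5.4, Cor. 5.6]
[cite: MilneADT2006, Ch. I §6 Prop. 6.9, Thm. 6.13 (a)] [cite: SilvermanAEC2009, III.8.1, X.4.2] -/
theorem card_mul_card_le_two_pow_two_mul_of_pairData_cmInert_of_finite
    [W.IsElliptic] [W.IsGloballyMinimal] [NeZero (W.conductorNorm ℤ)] [(twin W K).IsElliptic]
    (hCM : W.HasCM) (hin : Literature.NumberTheory.EllipticCurves.Rank1Residual.CMInert W 2)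
    (hρ : W.HasSurjectiveModNGaloisRep 2) (hK : IsImaginaryQuadratic K) (hoddK : Odd (NumberField.discr K))
    (hH : SatisfiesHeegnerHypothesis (W.conductorNorm ℤ) K)
    {P₀ : (W.baseChange K).toAffine.Point} (hP₀ : IsHeegnerPoint (W.conductorNorm ℤ) W K P₀)
    {L : ℕ} (hL1 : 1 ≤ L)
    -- the two-member descent data on the `ℚ`-pair carrier
    (D : PairDataM (galH1Torsion W (lvl (L + L))) (galH1Torsion (twin W K) (lvl (L + L)))
      (HeightOneSpectrum (𝓞 ℚ) ⊕ InfinitePlace ℚ))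
    (hDp : D.p = 2) (hDM : D.M = L + L)
    (hDSel₁ : D.Sel₁ = selmerGroup W (lvl (L + L)))
    (hDSel₂ : D.Sel₂ = selmerGroup (twin W K) (lvl (L + L)))
    (hDLoc₁ : D.Loc₁ = loc₁ W (L + L)) (hDLoc₂ : D.Loc₂ = loc₂ W K (L + L))
    (hDA₁ : D.A₁ = a₁ W (L + L)) (hDA₂ : D.A₂ = a₂ W K (L + L))
    (hDpl : D.pl = pl) (hDDv : D.Dv = Dv)
    (hDKol : ∀ ℓ, D.Kol ℓ ↔ IsKolyvaginPrime (W.conductorNorm ℤ) W K 2 ℓ ∧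
      FrobEqFrobInfty W K (2 ^ (L + L + 1)) ℓ ∧ kolPrime W K (L + L) ℓ)
    (hM₀L : D.M₀ ≤ L)
    -- finiteness of the two Tate–Shafarevich groups, `L` beyond their `2`-adic size
    [Finite W.sha] [Finite (twin W K).sha]
    (hLsha₁ : padicValNat 2 (Nat.card W.sha) ≤ L) (hLsha₂ : padicValNat 2 (Nat.card (twin W K).sha) ≤ L)
    -- rank one on `E`: the kernel of `Sel_{2^{2L}}(E) → H¹(ℚ, E)` is `ℤ · D.x`; rank zero on `E^{(d_K)}`: that kernel vanishes
    (hkerT : ∀ z : selmerGroup W (lvl (L + L)),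
      torsionH1ToH1 W (lvl (L + L)) z = 0 ↔ (z : galH1Torsion W (lvl (L + L))) ∈ AddSubgroup.zmultiples D.x)
    (hinjT : ∀ z : selmerGroup (twin W K) (lvl (L + L)), torsionH1ToH1 (twin W K) (lvl (L + L)) z = 0 → z = 0) :
    Nat.card ((W.sha)[(2 ^ L : ℕ)]) * Nat.card (selmerGroup (twin W K) (lvl (L + L))) ≤ 2 ^ (2 * D.M₀) := by
  haveI : NeZero (2 ^ L * 2 ^ L) := ⟨by positivity⟩
  have hL2 : 2 ≤ 2 ^ L * 2 ^ L := by
    have h := Nat.one_lt_two_pow (show L ≠ 0 by omega)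
    nlinarith
  have hmQ : ((2 ^ L * 2 ^ L : ℕ) : ℚ) ≠ 0 := by positivity
  -- ### the Cassels–Tate package of `E` and of `E^{(d_K)}`
  obtain ⟨e₁, hμ₁, hadd₁₁, hadd₂₁, halt₁, hnondeg₁, hgal₁⟩ := exists_weilPairing_holds W (2 ^ L * 2 ^ L) hL2 hmQ
  obtain ⟨e₂, hμ₂, hadd₁₂, hadd₂₂, halt₂, hnondeg₂, hgal₂⟩ := exists_weilPairing_holds (twin W K) (2 ^ L * 2 ^ L) hL2 hmQ
  have hkill₁ := zsmul_pow_eq_zero_of_finite_of_padicValNat_le W.sha hLsha₁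
  have hkill₂ := zsmul_pow_eq_zero_of_finite_of_padicValNat_le (twin W K).sha hLsha₂
  obtain ⟨ι₁, hι₁⟩ := exists_selmerToSha_of_finite W hLsha₁
  obtain ⟨ι₂, hι₂⟩ := exists_selmerToSha_of_finite (twin W K) hLsha₂
  -- ### the rank inputs through `ι`
  have hker : ∀ z : selmerGroup W (lvl (L + L)),
      ι₁ z = 0 ↔ (z : galH1Torsion W (lvl (L + L))) ∈ AddSubgroup.zmultiples D.x := by
    intro z
    rw [← hkerT z, ← hι₁ z]
    constructor
    · intro h
      rw [h]
      rfl
    · intro h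
      exact Subtype.ext (Subtype.ext h)
  have hι₂inj : Function.Injective ι₂ := by
    refine (injective_iff_map_eq_zero ι₂).mpr fun z hz ↦ hinjT z ?_
    rw [← hι₂ z, hz]
    rfl
  exact card_mul_card_le_two_pow_two_mul_of_pairData_cmInert_of_kill W hCM hin hρ hK hoddK hH hP₀ hL1 D hDp hDM hDSel₁
    hDSel₂ hDLoc₁ hDLoc₂ hDA₁ hDA₂ hDpl hDDv hDKol hM₀L hkill₁ e₁ hμ₁ hadd₁₁ hadd₂₁ hgal₁ halt₁ hnondeg₁ ι₁ hι₁ hkill₂ e₂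
    hμ₂ hadd₁₂ hadd₂₂ hgal₂ halt₂ hnondeg₂ ι₂ hι₂ hker hι₂inj

end Summit.BirchSwinnertonDyer.BirchSwinnertonDyer.Theorems.KolyvaginPairDataTwo

end
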